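/- Free-seat work of EXTRA WIDTH SEAT `ym-line-cbag-p1-w4` (prover-ym-line-cbag-p1-w4-g2-0), route `EguchiKawaiDirectionLadder`
(ideator ym-idea-2, LINE 8), crux `TripleSmallBallMargin` (stmt-QuantumFields-27724): stage S9-alg of the LEAD's architecture note
(ARCH-27724-lead-g24.md §3(ii), stub S9 «Abs»): the compressed commutator of a pair of links right-multiplied by block-diagonal
unitaries, with bounds UNIFORM in the block unitaries.  ROUTE-INDEPENDENT.  Nothing here bears on the Yang–Mills mass gap. -/
import Summits.QuantumFields.YangMills.Theorems.EguchiKawaiDirectionLadderBlockDiagonalDefs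
import Summits.QuantumFields.YangMills.Theorems.EguchiKawaiDirectionLadderCompressionSplit
import HarnessLib

/-!
# Route `EguchiKawaiDirectionLadder`: block-pair algebra for the absorption step (S9-alg)

In the absorption step one replaces the Haar links `(X, Y)` (in the eigenbasis of `U 0`) by `(X·ι(D), Y·ι(D′))` with `D, D′` independent
block-diagonal unitaries for a labelling `ℓ : Fin N → Fin m` (`…BlockDiagonalDefs`, `…HaarAbsorption`).  This file computes the diagonal
block `c` of their commutator and bounds every cross term UNIFORMLY in `D, D′`:

* `toBlock_commutator_mul_blockDiag_eq_sum` —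
  `([X·ι(D), Y·ι(D′)])_{cc} = Σ_a (X_{ca} D_a · Y_{ac} D′_c − Y_{ca} D′_a · X_{ac} D_c)`, and `…_eq_diag_add_cross` — the `a = c` term
  `X_{cc}D_c · Y_{cc}D′_c − Y_{cc}D′_c · X_{cc}D_c` (the within-block pair fed to `haar_prod_robustPairEvent_transfer`) plus the cross terms `a ≠ c`;
* D-UNIFORM BOUNDS on a cross term: Frobenius `Σ|X_{ca}D_a Y_{ac}D′_c|² ≤ Σ|X_{ca}|² · Σ|Y_{ac}|²` (`sum_norm_sq_crossTerm_le`: labelled blocks, both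
  factors small by entrywise rigidity) and rank `≤ #{ℓ = a}` (`rank_crossTerm_le_card`: the collar block, unconstrained but thin);
* invariances used to condition on `(X, Y)`: off-block Frobenius masses of `X·ι(D)` equal those of `X` (`sum_norm_sq_toBlock_mul_blockDiag`),
  and blocks where `D_a = 1` are untouched (`toBlock_mul_blockDiag_of_eq_one`);
* rectangular Frobenius isometries `sum_norm_sq_mul_unitary'` / `sum_norm_sq_unitary_mul'` (any finite row/column types).

HONEST FRAMING: linear algebra only.  The route bears on the barrier-ledger fact `EguchiKawaiBreakdown` only.
-/

set_option autoImplicit false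

noncomputable section

open scoped Matrix
open Literature.Barriers.QuantumFields

namespace Summit.QuantumFields.YangMills.Theorems.EguchiKawaiDirectionLadder

/-! ### §1 Rectangular Frobenius isometries of unitary multiplication -/

section Isometry

variable {β γ : Type*} [Fintype β] [Fintype γ] [DecidableEq γ] [DecidableEq β]

omit [DecidableEq β] in
/-- Right multiplication by a unitary preserves the Frobenius mass of a rectangular matrix. -/
theorem sum_norm_sq_mul_unitary' (A : Matrix β γ ℂ) (U : Matrix.unitaryGroup γ ℂ) :
    ∑ i, ∑ j, ‖(A * (U : Matrix γ γ ℂ)) i j‖ ^ 2 = ∑ i, ∑ j, ‖A i j‖ ^ 2 := by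
  have h1 := trace_mul_conjTranspose_eq_sum (A * (U : Matrix γ γ ℂ))
  have h2 := trace_mul_conjTranspose_eq_sum A
  have hU : (U : Matrix γ γ ℂ) * (U : Matrix γ γ ℂ)ᴴ = 1 := by
    have h := Matrix.mem_unitaryGroup_iff.mp U.2
    rwa [Matrix.star_eq_conjTranspose] at h
  have h3 : A * (U : Matrix γ γ ℂ) * (A * (U : Matrix γ γ ℂ))ᴴ = A * Aᴴ := by
    rw [Matrix.conjTranspose_mul, Matrix.mul_assoc, ← Matrix.mul_assoc (U : Matrix γ γ ℂ), hU, Matrix.one_mul]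
  rw [h3, h2] at h1
  exact_mod_cast h1.symm

omit [DecidableEq γ] in
/-- Left multiplication by a unitary preserves the Frobenius mass of a rectangular matrix. -/
theorem sum_norm_sq_unitary_mul' (U : Matrix.unitaryGroup β ℂ) (B : Matrix β γ ℂ) :
    ∑ i, ∑ j, ‖((U : Matrix β β ℂ) * B) i j‖ ^ 2 = ∑ i, ∑ j, ‖B i j‖ ^ 2 := by
  have h1 := trace_mul_conjTranspose_eq_sum ((U : Matrix β β ℂ) * B)
  have h2 := trace_mul_conjTranspose_eq_sum B
  have h3 : Matrix.trace ((U : Matrix β β ℂ) * B * ((U : Matrix β β ℂ) * B)ᴴ) = Matrix.trace (B * Bᴴ) := by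
    have hassoc : (U : Matrix β β ℂ) * B * (Bᴴ * (U : Matrix β β ℂ)ᴴ) =
        (U : Matrix β β ℂ) * (B * Bᴴ) * star (U : Matrix β β ℂ) := by
      rw [Matrix.star_eq_conjTranspose]; simp only [Matrix.mul_assoc]
    rw [Matrix.conjTranspose_mul, hassoc, Matrix.trace_mul_cycle, Matrix.UnitaryGroup.star_mul_self, Matrix.one_mul]
  rw [h3, h2] at h1
  exact_mod_cast h1.symm

end Isometry

/-! ### §2 The diagonal block of the commutator of right-block-multiplied links -/

section BlockPair

variable {N m : ℕ}

/-- **Compressed commutator of `(X·ι(D), Y·ι(D′))`, labelled form**: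
`([X·ι(D), Y·ι(D′)])_{cc} = Σ_a (X_{ca} D_a · Y_{ac} D′_c − Y_{ca} D′_a · X_{ac} D_c)`. -/
theorem toBlock_commutator_mul_blockDiag_eq_sum (ℓ : Fin N → Fin m) (X Y : Matrix (Fin N) (Fin N) ℂ)
    (V V' : (a : Fin m) → Matrix {i : Fin N // ℓ i = a} {i : Fin N // ℓ i = a} ℂ) (c : Fin m) :
    (X * blockDiag ℓ V * (Y * blockDiag ℓ V') - Y * blockDiag ℓ V' * (X * blockDiag ℓ V)).toBlock
        (fun i => ℓ i = c) (fun i => ℓ i = c) =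
      ∑ a, (X.toBlock (fun i => ℓ i = c) (fun i => ℓ i = a) * V a *
          (Y.toBlock (fun i => ℓ i = a) (fun i => ℓ i = c) * V' c) -
        Y.toBlock (fun i => ℓ i = c) (fun i => ℓ i = a) * V' a *
          (X.toBlock (fun i => ℓ i = a) (fun i => ℓ i = c) * V c)) := by
  rw [toBlock_commutator_eq_sum_fiber ℓ]
  refine Finset.sum_congr rfl fun a _ => ?_
  rw [toBlock_mul_blockDiag, toBlock_mul_blockDiag, toBlock_mul_blockDiag, toBlock_mul_blockDiag]

/-- The same, with the within-block pair separated from the cross terms: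
`([X·ι(D), Y·ι(D′)])_{cc} = (X_{cc}D_c · Y_{cc}D′_c − Y_{cc}D′_c · X_{cc}D_c) + Σ_{a ≠ c} (cross terms)`. -/
theorem toBlock_commutator_mul_blockDiag_eq_diag_add_cross (ℓ : Fin N → Fin m) (X Y : Matrix (Fin N) (Fin N) ℂ)
    (V V' : (a : Fin m) → Matrix {i : Fin N // ℓ i = a} {i : Fin N // ℓ i = a} ℂ) (c : Fin m) :
    (X * blockDiag ℓ V * (Y * blockDiag ℓ V') - Y * blockDiag ℓ V' * (X * blockDiag ℓ V)).toBlock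
        (fun i => ℓ i = c) (fun i => ℓ i = c) =
      (X.toBlock (fun i => ℓ i = c) (fun i => ℓ i = c) * V c * (Y.toBlock (fun i => ℓ i = c) (fun i => ℓ i = c) * V' c) -
        Y.toBlock (fun i => ℓ i = c) (fun i => ℓ i = c) * V' c * (X.toBlock (fun i => ℓ i = c) (fun i => ℓ i = c) * V c)) +
      ∑ a ∈ Finset.univ.erase c,
        (X.toBlock (fun i => ℓ i = c) (fun i => ℓ i = a) * V a * (Y.toBlock (fun i => ℓ i = a) (fun i => ℓ i = c) * V' c) -
          Y.toBlock (fun i => ℓ i = c) (fun i => ℓ i = a) * V' a * (X.toBlock (fun i => ℓ i = a) (fun i => ℓ i = c) * V c)) := by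
  rw [toBlock_commutator_mul_blockDiag_eq_sum, ← Finset.add_sum_erase _ _ (Finset.mem_univ c)]

/-! ### §3 Bounds on the cross terms, uniform in the block unitaries -/

/-- **Frobenius bound of a cross term** (labelled blocks): for unitary blocks `D_a`, `D′_c`,
`Σ|(X_{ca} D_a · Y_{ac} D′_c)_{ij}|² ≤ Σ|X_{ca}|² · Σ|Y_{ac}|²` — independent of the blocks. -/
theorem sum_norm_sq_crossTerm_le (ℓ : Fin N → Fin m) (X Y : Matrix (Fin N) (Fin N) ℂ) (V V' : BlockUnitaries ℓ) (c a : Fin m) :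
    ∑ i, ∑ j, ‖(X.toBlock (fun i => ℓ i = c) (fun i => ℓ i = a) * (V a : Matrix {i : Fin N // ℓ i = a} {i : Fin N // ℓ i = a} ℂ) *
        (Y.toBlock (fun i => ℓ i = a) (fun i => ℓ i = c) *
          (V' c : Matrix {i : Fin N // ℓ i = c} {i : Fin N // ℓ i = c} ℂ))) i j‖ ^ 2 ≤
      (∑ i, ∑ j, ‖X.toBlock (fun i => ℓ i = c) (fun i => ℓ i = a) i j‖ ^ 2) *
        ∑ i, ∑ j, ‖Y.toBlock (fun i => ℓ i = a) (fun i => ℓ i = c) i j‖ ^ 2 := by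
  calc _ ≤ (∑ i, ∑ j, ‖(X.toBlock (fun i => ℓ i = c) (fun i => ℓ i = a) *
          (V a : Matrix {i : Fin N // ℓ i = a} {i : Fin N // ℓ i = a} ℂ)) i j‖ ^ 2) *
        ∑ i, ∑ j, ‖(Y.toBlock (fun i => ℓ i = a) (fun i => ℓ i = c) *
          (V' c : Matrix {i : Fin N // ℓ i = c} {i : Fin N // ℓ i = c} ℂ)) i j‖ ^ 2 :=
          sum_norm_sq_mul_le_mul _ _
    _ = _ := by rw [sum_norm_sq_mul_unitary', sum_norm_sq_mul_unitary']

/-- **Rank bound of a cross term** (the collar block): `rank (X_{ca} D_a · Y_{ac} D′_c) ≤ #{ℓ = a}` — independent of the blocks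
and of `X, Y`. -/
theorem rank_crossTerm_le_card (ℓ : Fin N → Fin m) (X Y : Matrix (Fin N) (Fin N) ℂ)
    (V V' : (a : Fin m) → Matrix {i : Fin N // ℓ i = a} {i : Fin N // ℓ i = a} ℂ) (c a : Fin m) :
    (X.toBlock (fun i => ℓ i = c) (fun i => ℓ i = a) * V a *
        (Y.toBlock (fun i => ℓ i = a) (fun i => ℓ i = c) * V' c)).rank ≤ Fintype.card {i : Fin N // ℓ i = a} :=
  ((Matrix.rank_mul_le_left _ _).trans (Matrix.rank_mul_le_left _ _)).trans (Matrix.rank_le_card_width _)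

/-! ### §4 What right block-multiplication does NOT change -/

/-- Off-block (and any label-column block) Frobenius masses are invariant: `Σ|(X·ι(D))_{p,a}|² = Σ|X_{p,a}|²`. -/
theorem sum_norm_sq_toBlock_mul_blockDiag (ℓ : Fin N → Fin m) (X : Matrix (Fin N) (Fin N) ℂ) (V : BlockUnitaries ℓ)
    (p : Fin N → Prop) [DecidablePred p] (a : Fin m) :
    ∑ i, ∑ j, ‖(X * blockDiag ℓ (fun b => (V b : Matrix {i : Fin N // ℓ i = b} {i : Fin N // ℓ i = b} ℂ))).toBlock p
        (fun i => ℓ i = a) i j‖ ^ 2 =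
      ∑ i, ∑ j, ‖X.toBlock p (fun i => ℓ i = a) i j‖ ^ 2 := by
  rw [toBlock_mul_blockDiag, sum_norm_sq_mul_unitary']

/-- Blocks where the block unitary is `1` are untouched: `(X·ι(D))_{p,a} = X_{p,a}` if `D_a = 1`. -/
theorem toBlock_mul_blockDiag_of_eq_one (ℓ : Fin N → Fin m) (X : Matrix (Fin N) (Fin N) ℂ)
    (V : (a : Fin m) → Matrix {i : Fin N // ℓ i = a} {i : Fin N // ℓ i = a} ℂ) (p : Fin N → Prop) {a : Fin m}
    (ha : V a = 1) :
    (X * blockDiag ℓ V).toBlock p (fun i => ℓ i = a) = X.toBlock p (fun i => ℓ i = a) := by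
  rw [toBlock_mul_blockDiag, ha, Matrix.mul_one]

/-- In particular the ENTRIES of `X·ι(D)` in any column of a block with `D_a = 1` are those of `X`. -/
theorem mul_blockDiag_apply_of_eq_one (ℓ : Fin N → Fin m) (X : Matrix (Fin N) (Fin N) ℂ)
    (V : (a : Fin m) → Matrix {i : Fin N // ℓ i = a} {i : Fin N // ℓ i = a} ℂ) {a : Fin m} (ha : V a = 1)
    (i j : Fin N) (hj : ℓ j = a) :
    (X * blockDiag ℓ V) i j = X i j := by
  have h := toBlock_mul_blockDiag_of_eq_one ℓ X V (fun _ => True) ha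
  have h' := congrFun (congrFun h ⟨i, trivial⟩) ⟨j, hj⟩
  simpa [Matrix.toBlock_apply] using h'

end BlockPair

end Summit.QuantumFields.YangMills.Theorems.EguchiKawaiDirectionLadder

end
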